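import Summits.Ventures.QEC.Census.BB.BB288.CoverL21Q13Data
import HarnessLib

set_option Elab.async false

/-!
# `[[288,12,18]]` cover certificate — level-2→1 problem 13: scan CHUNKS 9–14 of 41 (chunk `i` = the selections whose
first row is `i`, budget 4 over the later rows; ≈ 159143 selections in this file), plain `decide`.
-/

namespace Summit.Ventures.QEC.Census.BB288Cover

open Summit.Ventures.QEC.Census

/-- Chunk 9 of problem 13 (36457 selections; first selected row = 9). -/
theorem q13_chunk9 : scan (bzLeaf 5 q13.allow) ((rowPos q13Gc 0).drop (9 + 1)) 4
    (2 ^ 41 ^^^ ((rowPos q13Gc 0)[9]'(by decide)).1) (q13c0 ^^^ ((rowPos q13Gc 0)[9]'(by decide)).2) = true := by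
  decide +kernel

/-- Chunk 10 of problem 13 (31931 selections; first selected row = 10). -/
theorem q13_chunk10 : scan (bzLeaf 5 q13.allow) ((rowPos q13Gc 0).drop (10 + 1)) 4
    (2 ^ 41 ^^^ ((rowPos q13Gc 0)[10]'(by decide)).1) (q13c0 ^^^ ((rowPos q13Gc 0)[10]'(by decide)).2) = true := by
  decide +kernel

/-- Chunk 11 of problem 13 (27841 selections; first selected row = 11). -/
theorem q13_chunk11 : scan (bzLeaf 5 q13.allow) ((rowPos q13Gc 0).drop (11 + 1)) 4
    (2 ^ 41 ^^^ ((rowPos q13Gc 0)[11]'(by decide)).1) (q13c0 ^^^ ((rowPos q13Gc 0)[11]'(by decide)).2) = true := by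
  decide +kernel

/-- Chunk 12 of problem 13 (24158 selections; first selected row = 12). -/
theorem q13_chunk12 : scan (bzLeaf 5 q13.allow) ((rowPos q13Gc 0).drop (12 + 1)) 4
    (2 ^ 41 ^^^ ((rowPos q13Gc 0)[12]'(by decide)).1) (q13c0 ^^^ ((rowPos q13Gc 0)[12]'(by decide)).2) = true := by
  decide +kernel

/-- Chunk 13 of problem 13 (20854 selections; first selected row = 13). -/
theorem q13_chunk13 : scan (bzLeaf 5 q13.allow) ((rowPos q13Gc 0).drop (13 + 1)) 4
    (2 ^ 41 ^^^ ((rowPos q13Gc 0)[13]'(by decide)).1) (q13c0 ^^^ ((rowPos q13Gc 0)[13]'(by decide)).2) = true := by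
  decide +kernel

/-- Chunk 14 of problem 13 (17902 selections; first selected row = 14). -/
theorem q13_chunk14 : scan (bzLeaf 5 q13.allow) ((rowPos q13Gc 0).drop (14 + 1)) 4
    (2 ^ 41 ^^^ ((rowPos q13Gc 0)[14]'(by decide)).1) (q13c0 ^^^ ((rowPos q13Gc 0)[14]'(by decide)).2) = true := by
  decide +kernel

end Summit.Ventures.QEC.Census.BB288Cover
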